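import Mathlib.AlgebraicGeometry.Stalk
import Mathlib.AlgebraicGeometry.Morphisms.Separated
import Mathlib.AlgebraicGeometry.Properties
import Mathlib.Algebra.Category.Ring.Instances
import Literature.RingTheory.CompleteLocalRings.FormalImmersionRigidity
import HarnessLib

/-!
# Sections through a point at which a morphism of schemes is a formal immersion coincide

Topic `Literature/AlgebraicGeometry/Morphisms`. B. Mazur, *Rational isogenies of prime degree*,
Invent. Math. 44 (1978), §3 p. 142: "If `f : X → Y` is a morphism of finite type between noetherian
schemes, we shall say that `f` is a *formal immersion at a point `x`* if the induced map on the
completions of local rings `𝒪̂_{Y,f(x)} → 𝒪̂_{X,x}` is surjective. This is equivalent to asking that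
the map induce an isomorphism between residue fields of `x` and `f(x)`, and that `f` be formally
unramified at `x` ([44] EGA IV 17.4.4)"; and the use made of it in the proof of Cor. 4.3, p. 145
(the "key point" spelled out there): two sections `Spec 𝒪_𝔭 → X₀(N)` which "cross" at the point
`∞̄` of the closed fibre, at which `f : X₀(N)^smooth → J̃` is a formal immersion, and which have the
same image under `f`, are equal. This file is the scheme-theoretic wrapper of
`Literature/RingTheory/CompleteLocalRings/FormalImmersionRigidity.lean`, through Mathlib's
`AlgebraicGeometry.SpecToEquivOfLocalRing` (morphisms `Spec R → X`, `R` local, correspond to points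
`x` together with a local homomorphism `𝒪_{X,x} → R`).

Throughout, "**`f` is a formal immersion at `x`**" is the hypothesis, written out,
`H : ∀ k, Function.Surjective ((Ideal.Quotient.mk (𝔪_x ^ k)).comp (f.stalkMap x).hom)` — for every
`k` the composite `𝒪_{Y,f(x)} → 𝒪_{X,x} → 𝒪_{X,x}/𝔪_xᵏ` is onto (the level-wise form of the
surjectivity of `𝒪̂_{Y,f(x)} → 𝒪̂_{X,x}`: `𝒪̂_{X,x} → 𝒪_{X,x}/𝔪ᵏ` is onto and
`𝒪̂_{Y,f(x)} → 𝒪_{X,x}/𝔪ᵏ` factors through `𝒪_{Y,f(x)}/𝔪ᵏ`; conversely by successive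
approximation for noetherian local rings). No new definition is introduced (theorem-only file).

* `forall_surjective_iff_forall_exists_sub_mem` — unfolding to germs;
* `forall_surjective_of_cotangent`, `surjective_residueFieldMap_of_forall_surjective`,
  `maximalIdeal_le_sup_of_forall_surjective`, `forall_surjective_iff_cotangent` — **EGA IV 17.4.4
  in cotangent form**: formal immersion at `x` iff `k(f(x)) → k(x)` is onto and
  `𝔪_x ≤ f^#(𝔪_{f(x)})𝒪_{X,x} + 𝔪_x²` (cotangent map onto) — the form in which Mazur's Prop. 3.1
  proves it (`Cot(J̃) → Cot_∞̄(X₀(N)/k) ≅ k` nonzero);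
* `stalk_hom_ext_of_forall_surjective` — two local homomorphisms `𝒪_{X,x} → R` into a
  noetherian local ring agreeing on `𝒪_{Y,f(x)}` are equal;
* `eq_of_SpecMap_comp_fromSpecStalk_eq` — injectivity of `SpecToEquivOfLocalRing` on a fibre;
* `hom_ext_of_forall_surjective` — **rigidity of sections** (Mazur 1978, p. 145): `R` noetherian
  local, `s, t : Spec R ⟶ X` sending the closed point to `x`, `s ≫ f = t ≫ f` ⟹ `s = t`;
* `hom_ext_of_forall_surjective_of_isSeparated`, `hom_ext_of_forall_surjective_of_injective` —
  the same for sections over a reduced base `T` of a separated `X → T` (Mazur's printed setting: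
  two `𝒪`-sections of `X₀(N)`, `𝒪` a ring of `S`-integers, which "cross" at a prime `𝔭`), reduced
  to the local case along a dominant `Spec R → T` (e.g. `Spec 𝒪_𝔭 → Spec 𝒪`) by Mathlib's
  `ext_of_isDominant_of_isSeparated`.

## References

* [Mazur1978] B. Mazur, *Rational isogenies of prime degree*, Invent. Math. 44 (1978) 129–162,
  §3 p. 142; proof of Cor. 4.3, p. 145.
* [Grothendieck1967] EGA IV₄, 17.4.4.
-/

noncomputable section

open CategoryTheory AlgebraicGeometry IsLocalRing

namespace Literature.AlgebraicGeometry.Morphisms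

open Literature.RingTheory.CompleteLocalRings

universe u

variable {X Y : Scheme.{u}} {f : X ⟶ Y} {x : X}

/-! ## Formal immersion at a point: unfolding and the cotangent criterion -/

/-- Unfolding: `𝒪_{Y,f(x)} → 𝒪_{X,x}/𝔪_xᵏ` is onto for every `k` (formal immersion at `x`,
Mazur 1978 §3 p. 142) iff every germ `b ∈ 𝒪_{X,x}` is congruent modulo every power `𝔪_xᵏ` to a
germ pulled back from `𝒪_{Y,f(x)}`. [cite: Mazur1978, §3 p. 142] -/
theorem forall_surjective_iff_forall_exists_sub_mem :
    (∀ k : ℕ, Function.Surjective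
      ((Ideal.Quotient.mk (maximalIdeal (X.presheaf.stalk x) ^ k)).comp (f.stalkMap x).hom)) ↔
    ∀ (k : ℕ) (b : X.presheaf.stalk x), ∃ a : Y.presheaf.stalk (f.base x),
      (f.stalkMap x).hom a - b ∈ maximalIdeal (X.presheaf.stalk x) ^ k := by
  refine ⟨fun H k b => ?_, fun H k q => ?_⟩
  · obtain ⟨a, ha⟩ := H k (Ideal.Quotient.mk _ b)
    exact ⟨a, (Ideal.Quotient.eq).mp ha⟩
  · obtain ⟨b, rfl⟩ := Ideal.Quotient.mk_surjective q
    obtain ⟨a, ha⟩ := H k b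
    exact ⟨a, (Ideal.Quotient.eq).mpr ha⟩

/-- **Cotangent criterion (EGA IV 17.4.4) for a formal immersion at a point.** If the stalk map
`f^# : 𝒪_{Y,f(x)} → 𝒪_{X,x}` is onto on residue fields and onto on cotangent spaces
(`𝔪_x ≤ f^#(𝔪_{f(x)})𝒪_{X,x} + 𝔪_x²`), then `𝒪_{Y,f(x)} → 𝒪_{X,x}/𝔪_xᵏ` is onto for every `k`,
i.e. `f` is a formal immersion at `x`. This is how Mazur 1978, Prop. 3.1 establishes the formal
immersion `X₀(N)^smooth → J̃` along `∞` away from characteristic `2`.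
[cite: Mazur1978, §3 p. 142 (EGA IV 17.4.4)] -/
theorem forall_surjective_of_cotangent
    (hres : Function.Surjective (ResidueField.map (f.stalkMap x).hom))
    (hcot : maximalIdeal (X.presheaf.stalk x) ≤
      (maximalIdeal (Y.presheaf.stalk (f.base x))).map (f.stalkMap x).hom ⊔
        maximalIdeal (X.presheaf.stalk x) ^ 2) (k : ℕ) :
    Function.Surjective
      ((Ideal.Quotient.mk (maximalIdeal (X.presheaf.stalk x) ^ k)).comp (f.stalkMap x).hom) := by
  have hφ := map_maximalIdeal_le (f.stalkMap x).hom
  have hres' := exists_sub_mem_maximalIdeal_of_surjective_residueFieldMap (f.stalkMap x).hom hres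
  exact surjective_mk_pow_comp (f.stalkMap x).hom hφ hres'
    (exists_mem_sub_mem_sq_of_le_sup_sq (f.stalkMap x).hom hφ hres' hcot) k

/-- A formal immersion at `x` is onto on residue fields: `k(f(x)) → k(x)` is surjective (hence an
isomorphism). [cite: Mazur1978, §3 p. 142] -/
theorem surjective_residueFieldMap_of_forall_surjective
    (H : ∀ k : ℕ, Function.Surjective
      ((Ideal.Quotient.mk (maximalIdeal (X.presheaf.stalk x) ^ k)).comp (f.stalkMap x).hom)) :
    Function.Surjective (ResidueField.map (f.stalkMap x).hom) := by
  intro ξ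
  obtain ⟨b, rfl⟩ := residue_surjective ξ
  obtain ⟨a, ha⟩ := forall_surjective_iff_forall_exists_sub_mem.mp H 1 b
  refine ⟨residue _ a, ?_⟩
  rw [ResidueField.map_residue]
  exact (Ideal.Quotient.eq).mpr (by simpa using ha)

/-- A formal immersion at `x` is onto on cotangent spaces:
`𝔪_x ≤ f^#(𝔪_{f(x)})𝒪_{X,x} + 𝔪_x²`. [cite: Mazur1978, §3 p. 142] -/
theorem maximalIdeal_le_sup_of_forall_surjective
    (H : ∀ k : ℕ, Function.Surjective
      ((Ideal.Quotient.mk (maximalIdeal (X.presheaf.stalk x) ^ k)).comp (f.stalkMap x).hom)) :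
    maximalIdeal (X.presheaf.stalk x) ≤
      (maximalIdeal (Y.presheaf.stalk (f.base x))).map (f.stalkMap x).hom ⊔
        maximalIdeal (X.presheaf.stalk x) ^ 2 := by
  intro y hy
  obtain ⟨a, ha⟩ := forall_surjective_iff_forall_exists_sub_mem.mp H 2 y
  have hφa : (f.stalkMap x).hom a ∈ maximalIdeal (X.presheaf.stalk x) := by
    have h2 : (f.stalkMap x).hom a - y ∈ maximalIdeal (X.presheaf.stalk x) :=
      Ideal.pow_le_self two_ne_zero ha
    simpa using Ideal.add_mem _ h2 hy
  have ha' : a ∈ maximalIdeal (Y.presheaf.stalk (f.base x)) := by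
    rw [← maximalIdeal_comap (f.stalkMap x).hom]
    exact hφa
  have e : y = (f.stalkMap x).hom a - ((f.stalkMap x).hom a - y) := by ring
  rw [e]
  exact Ideal.sub_mem _ (Ideal.mem_sup_left (Ideal.mem_map_of_mem _ ha'))
    (Ideal.mem_sup_right ha)

/-- **EGA IV 17.4.4, cotangent form, both directions**: `𝒪_{Y,f(x)} → 𝒪_{X,x}/𝔪_xᵏ` is onto
for every `k` (formal immersion at `x`) iff the stalk map is onto on residue fields and on
cotangent spaces. [cite: Mazur1978, §3 p. 142 (EGA IV 17.4.4)] -/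
theorem forall_surjective_iff_cotangent :
    (∀ k : ℕ, Function.Surjective
      ((Ideal.Quotient.mk (maximalIdeal (X.presheaf.stalk x) ^ k)).comp (f.stalkMap x).hom)) ↔
      Function.Surjective (ResidueField.map (f.stalkMap x).hom) ∧
        maximalIdeal (X.presheaf.stalk x) ≤
          (maximalIdeal (Y.presheaf.stalk (f.base x))).map (f.stalkMap x).hom ⊔
            maximalIdeal (X.presheaf.stalk x) ^ 2 :=
  ⟨fun H => ⟨surjective_residueFieldMap_of_forall_surjective H,
      maximalIdeal_le_sup_of_forall_surjective H⟩,
    fun H => forall_surjective_of_cotangent H.1 H.2⟩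

/-! ## Rigidity of sections -/

/-- **Rigidity at the level of stalks.** If `f` is a formal immersion at `x`
(`𝒪_{Y,f(x)} → 𝒪_{X,x}/𝔪_xᵏ` onto for all `k`), two local homomorphisms `σ, τ : 𝒪_{X,x} → R`
into a noetherian local ring which agree on `𝒪_{Y,f(x)}` (`f^# ≫ σ = f^# ≫ τ`) are equal.
[cite: Mazur1978, proof of Cor. 4.3, p. 145] -/
theorem stalk_hom_ext_of_forall_surjective
    (H : ∀ k : ℕ, Function.Surjective
      ((Ideal.Quotient.mk (maximalIdeal (X.presheaf.stalk x) ^ k)).comp (f.stalkMap x).hom))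
    {R : CommRingCat.{u}} [IsLocalRing R] [IsNoetherianRing R]
    {σ τ : X.presheaf.stalk x ⟶ R} [IsLocalHom σ.hom] [IsLocalHom τ.hom]
    (h : f.stalkMap x ≫ σ = f.stalkMap x ≫ τ) : σ = τ := by
  have h' : σ.hom.comp (f.stalkMap x).hom = τ.hom.comp (f.stalkMap x).hom := by
    rw [← CommRingCat.hom_comp, ← CommRingCat.hom_comp, h]
  ext1
  exact ringHom_ext_of_forall_exists_sub_mem_pow (f.stalkMap x).hom
    (forall_surjective_iff_forall_exists_sub_mem.mp H)
    (Ideal.iInf_pow_eq_bot_of_isLocalRing (maximalIdeal R) (maximalIdeal.isMaximal R).ne_top)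
    (maximalIdeal_comap σ.hom).ge (maximalIdeal_comap τ.hom).ge h'

/-- Two morphisms `Spec R ⟶ Y` built from local homomorphisms out of the SAME stalk `𝒪_{Y,y}`
are equal only if the homomorphisms are (injectivity of `SpecToEquivOfLocalRing` on a fibre).
[folklore] -/
theorem eq_of_SpecMap_comp_fromSpecStalk_eq {R : CommRingCat.{u}} [IsLocalRing R] {y : Y}
    {a b : Y.presheaf.stalk y ⟶ R} [IsLocalHom a.hom] [IsLocalHom b.hom]
    (h : Spec.map a ≫ Y.fromSpecStalk y = Spec.map b ≫ Y.fromSpecStalk y) : a = b := by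
  have hinj := (SpecToEquivOfLocalRing Y R).symm.injective
    (a₁ := ⟨y, a, inferInstance⟩) (a₂ := ⟨y, b, inferInstance⟩) h
  obtain ⟨-, h2⟩ := Sigma.mk.inj_iff.mp hinj
  exact congrArg Subtype.val (eq_of_heq h2)

/-- **Rigidity, sections through the stalk.** If `f` is a formal immersion at `x` and
`σ, τ : 𝒪_{X,x} → R` are local homomorphisms into a noetherian local ring whose associated
morphisms `Spec R ⟶ X` become equal after composing with `f`, then `σ = τ`.
[cite: Mazur1978, proof of Cor. 4.3, p. 145] -/
theorem ext_of_fromSpecStalk_of_forall_surjective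
    (H : ∀ k : ℕ, Function.Surjective
      ((Ideal.Quotient.mk (maximalIdeal (X.presheaf.stalk x) ^ k)).comp (f.stalkMap x).hom))
    {R : CommRingCat.{u}} [IsLocalRing R] [IsNoetherianRing R]
    {σ τ : X.presheaf.stalk x ⟶ R} [IsLocalHom σ.hom] [IsLocalHom τ.hom]
    (h : Spec.map σ ≫ X.fromSpecStalk x ≫ f = Spec.map τ ≫ X.fromSpecStalk x ≫ f) : σ = τ := by
  refine stalk_hom_ext_of_forall_surjective H
    (eq_of_SpecMap_comp_fromSpecStalk_eq (y := f.base x) ?_)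
  simpa only [Spec.map_comp, Category.assoc, Scheme.SpecMap_stalkMap_fromSpecStalk] using h

/-- **Rigidity of sections through a point of formal immersion** (Mazur 1978, proof of Cor. 4.3,
p. 145: the sections `x` and `∞` of `X₀(N)` over `Spec 𝒪_𝔭` "cross" at `𝔭` — both reduce to the
cusp `∞̄` — and have the same image, the zero section, under `f : X₀(N)^smooth → J̃`, which is a
formal immersion at `∞̄`; hence they coincide, a contradiction). Let `f : X ⟶ Y` be a formal
immersion at `x` (`𝒪_{Y,f(x)} → 𝒪_{X,x}/𝔪_xᵏ` onto for all `k`), `R` a noetherian local ring, and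
`s, t : Spec R ⟶ X` two morphisms sending the closed point to `x` with `s ≫ f = t ≫ f`. Then
`s = t`. [cite: Mazur1978, proof of Cor. 4.3, p. 145] -/
theorem hom_ext_of_forall_surjective
    (H : ∀ k : ℕ, Function.Surjective
      ((Ideal.Quotient.mk (maximalIdeal (X.presheaf.stalk x) ^ k)).comp (f.stalkMap x).hom))
    {R : CommRingCat.{u}} [IsLocalRing R] [IsNoetherianRing R] {s t : Spec R ⟶ X}
    (hs : s.base (closedPoint R) = x) (ht : t.base (closedPoint R) = x) (hst : s ≫ f = t ≫ f) :
    s = t := by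
  subst hs
  have e : Inseparable (t.base (closedPoint R)) (s.base (closedPoint R)) := Inseparable.of_eq ht
  -- `s` and `t` as local homomorphisms out of the stalk at the common point
  set σ : X.presheaf.stalk (s.base (closedPoint R)) ⟶ R := Scheme.stalkClosedPointTo s with hσ
  set τ : X.presheaf.stalk (s.base (closedPoint R)) ⟶ R :=
    (X.presheaf.stalkCongr e).inv ≫ Scheme.stalkClosedPointTo t with hτ
  have es : Spec.map σ ≫ X.fromSpecStalk _ = s := Scheme.Spec_stalkClosedPointTo_fromSpecStalk s
  have et : Spec.map τ ≫ X.fromSpecStalk _ = t := by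
    rw [hτ, Spec.map_comp, Category.assoc, TopCat.Presheaf.stalkCongr_inv,
      Scheme.SpecMap_stalkSpecializes_fromSpecStalk, Scheme.Spec_stalkClosedPointTo_fromSpecStalk]
  have key : σ = τ :=
    ext_of_fromSpecStalk_of_forall_surjective H (by rw [reassoc_of% es, reassoc_of% et, hst])
  rw [← es, ← et, key]

/-! ## Global form: sections over a reduced base which cross at a point -/

/-- The morphism `Spec S → Spec R` induced by an injective ring homomorphism `R → S` is dominant
(its image contains the generic points: the kernel is contained in the nilradical).
[folklore] -/
theorem isDominant_SpecMap_of_injective {R S : CommRingCat.{u}} (φ : R ⟶ S)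
    (hφ : Function.Injective φ.hom) : IsDominant (Spec.map φ) := by
  rw [isDominant_iff]
  have h : DenseRange (PrimeSpectrum.comap φ.hom) :=
    (PrimeSpectrum.denseRange_comap_iff_ker_le_nilRadical φ.hom).mpr
      (by rw [(RingHom.injective_iff_ker_eq_bot φ.hom).mp hφ]; exact bot_le)
  exact h

/-- **Rigidity of sections over a reduced base** (Mazur 1978, proof of Cor. 4.3, p. 145, in its
printed setting: "the two `𝒪`-sections of `X₀(N)`, `x` and `∞`, 'cross' at `𝔭`, and map to the
same section of `A` under `f` (the zero-section). But this contradicts the fact that `f` is a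
formal immersion at `∞/k(𝔭)`"). Let `q : X ⟶ T` be separated with `T` reduced, let
`s, t : T ⟶ X` satisfy `s ≫ q = t ≫ q` (e.g. two sections of `q`), and let `ι : Spec R ⟶ T` be a
dominant morphism from the spectrum of a noetherian local ring (e.g. `Spec 𝒪_𝔭 → Spec 𝒪`) such
that `ι ≫ s` and `ι ≫ t` both send the closed point to a point `x` at which `f : X ⟶ Y` is a
formal immersion (`𝒪_{Y,f(x)} → 𝒪_{X,x}/𝔪_xᵏ` onto for all `k`). If `s ≫ f = t ≫ f` then `s = t`:
the local case `hom_ext_of_forall_surjective` gives `ι ≫ s = ι ≫ t`, and two morphisms from a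
reduced scheme to a separated `T`-scheme which agree on a dominant `ι` agree
(`ext_of_isDominant_of_isSeparated`). [cite: Mazur1978, proof of Cor. 4.3, p. 145] -/
theorem hom_ext_of_forall_surjective_of_isSeparated
    (H : ∀ k : ℕ, Function.Surjective
      ((Ideal.Quotient.mk (maximalIdeal (X.presheaf.stalk x) ^ k)).comp (f.stalkMap x).hom))
    {T : Scheme.{u}} [IsReduced T] (q : X ⟶ T) [IsSeparated q] {s t : T ⟶ X}
    (hq : s ≫ q = t ≫ q) {R : CommRingCat.{u}} [IsLocalRing R] [IsNoetherianRing R]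
    (ι : Spec R ⟶ T) [IsDominant ι] (hs : (ι ≫ s).base (closedPoint R) = x)
    (ht : (ι ≫ t).base (closedPoint R) = x) (hst : s ≫ f = t ≫ f) : s = t :=
  ext_of_isDominant_of_isSeparated q hq ι
    (hom_ext_of_forall_surjective H hs ht (by rw [Category.assoc, Category.assoc, hst]))

/-- **Rigidity of sections over an affine reduced base, localized at a prime** — the case of
`hom_ext_of_forall_surjective_of_isSeparated` with `T = Spec 𝒪`, `𝒪` reduced, and
`ι = Spec(𝒪 → R)` for an injective ring homomorphism into a noetherian local ring `R` (e.g. the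
localization `𝒪 → 𝒪_𝔭` of a noetherian domain, or its completion): two morphisms
`s, t : Spec 𝒪 ⟶ X` over `Spec 𝒪` (`X → Spec 𝒪` separated) whose restrictions to `Spec R` pass
through a point `x` at which `f` is a formal immersion, and with `s ≫ f = t ≫ f`, are equal.
[cite: Mazur1978, proof of Cor. 4.3, p. 145] -/
theorem hom_ext_of_forall_surjective_of_injective
    (H : ∀ k : ℕ, Function.Surjective
      ((Ideal.Quotient.mk (maximalIdeal (X.presheaf.stalk x) ^ k)).comp (f.stalkMap x).hom))
    {O R : CommRingCat.{u}} [_root_.IsReduced O] [IsLocalRing R] [IsNoetherianRing R]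
    (φ : O ⟶ R) (hφ : Function.Injective φ.hom) (q : X ⟶ Spec O) [IsSeparated q]
    {s t : Spec O ⟶ X} (hq : s ≫ q = t ≫ q) (hs : (Spec.map φ ≫ s).base (closedPoint R) = x)
    (ht : (Spec.map φ ≫ t).base (closedPoint R) = x) (hst : s ≫ f = t ≫ f) : s = t :=
  haveI := isDominant_SpecMap_of_injective φ hφ
  hom_ext_of_forall_surjective_of_isSeparated H q hq (Spec.map φ) hs ht hst

end Literature.AlgebraicGeometry.Morphisms
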